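import Summits.BirchSwinnertonDyer.BirchSwinnertonDyer.Theorems.ClassRecordThreeHalvesAtThreeLeaves
import Summits.BirchSwinnertonDyer.BirchSwinnertonDyer.Theorems.ClassRecordThreeNormRigidityOneSided
import HarnessLib

/-!
# Route `ClassRecordThree`, crux `HalvesAtThree` (item stmt-BirchSwinnertonDyer-19107) — the H2 half
# `Three.BDPValueAt₃` from NORM CONTINUITY AT `𝟙` (VN₃): no unit, no `R₀`, no `p`-adic `L`-function in
# the hypothesis — only the 3-adic ABSOLUTE VALUES of Castella's normalised special values

Cell `bsd-stepL` (run/shared/lean/pub/bsd-stepL/), seat `bsd-stepL-thmc-p1` (prover g3, D-0074 hands, 2026-08-26),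
`--supports stmt-BirchSwinnertonDyer-19107`. Sequel to `Theorems/ClassRecordThreeHalvesAtThreeValueContinuity.lean`
(g2: H2 ⟸ (VC₃), VALUE continuity at `𝟙`: the displays tend to `u·c²` for some unit `u ∈ R₀ˣ`) and
`Theorems/ClassRecordThreeHalvesAtThreeLeaves.lean` (g3 §3: H2 is one 3-adic valuation per frame).

## What this file records in the kernel

1. **One-sided NORM rigidity** (companion file `Theorems/ClassRecordThreeNormRigidityOneSided.lean`,
   `intSeries_norm_constantCoeff_eq_of_tendsto_norm_of_values_mul_sq`, every `p`):
   if `Q' ∈ 𝓞_{ℂ_p}⟦T⟧` takes the values `a_k·v_k` at `T_k → 0` and `a_k²·w_k` at `T_k(T_k+2)` with `a_k ≠ 0`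
   and ONLY THE NORMS `‖v_k‖, ‖w_k‖ → N ≠ 0` converging (in `ℝ`; no convergence of `v_k`, `w_k` in `ℂ_p` asked),
   then `‖[T⁰]Q'‖ = N`. Proof = the VALUE version's (x11b3-p3 S27 ∕ multr1-p2 gen 25,
   `intSeries_constantCoeff_eq_of_tendsto_of_values_mul_sq`) read through `‖·‖`: `‖a_k‖ → σ = ‖[T⁰]Q'‖/N` and
   `‖a_k‖² → σ`, so `σ ∈ {0,1}`; `σ = 0` contradicts the order lemma `intSeries_norm_value_eq_of_order`, which gives
   `‖a_k‖·‖w_k‖ = ‖2‖^d·‖v_k‖` for large `k` (left side → 0, right side → ‖2‖^d·N ≠ 0).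
2. **The BDP form** (same companion, `intSeries_norm_constantCoeff_eq_of_isBDPLFunctionInt_of_continuousNorms`, odd `p`, `K`
   imaginary quadratic, `κ` anticyclotomic with generator `γ`): if for SOME non-zero virtual periods `(Ω_K, Ω_p)`
   the NORMS `‖ι⁻¹(bdpInterpolationValue p f 𝔭 φ_k n_k Ω_K)·Ω_p^{4n_k}‖` tend to `N ≠ 0` along every interpolation
   sequence with `r_k(γ) → 1`, then every ♭-frame `Q'` of the same `(ι, 𝔭, κ, γ, f)` has `‖[T⁰]Q'‖ = N` (supply:
   the THEOREM `exists_interpolationSupply_pow`; transport: `intSeries_hasValueAt_frame_rescale`).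
3. **H2@3 from NORM CONTINUITY (VN₃)** (`bdpValueAt₃_of_normContinuity`): if at every X11b@3 classical datum and
   every `ι'` inducing `𝔭` there are `Ω_K ≠ 0`, `Ω_p ≠ 0` with
   `‖ι'⁻¹(bdpInterpolationValue 3 f 𝔭 φ_k n_k Ω_K)·Ω_p^{4n_k}‖₃ → ‖(1 − a₃(E)·3⁻¹)·log_{ω_E} P‖₃²` along every
   interpolation sequence, then `Three.BDPValueAt₃ W` — by 2 and g3's `bdpValueAt₃_iff_norm_constantCoeff` (H2 is
   the norm identity `‖[T⁰]L‖ = ‖c‖²` per frame). (VN₃) is WEAKER than (VC₃) (`normContinuity₃_of_valueContinuity`: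
   take norms; `‖u‖ = 1`), hence than THEOREM C typed (`normContinuity₃_of_classicalFrameValue`). So the kernel
   chain is now THEOREM C typed ⟹ (VC₃) ⟹ (VN₃) ⟹ `Three.BDPValueAt₃ W`, and the H2@3 price is a statement about
   3-adic VALUATIONS of normalised central values `L(f/K, φ_k, 1)` near `𝟙` — `ord₃` data, the observable of the
   cell's STEP-0-H2 tables (PROOF-BDP §20.6).
4. Item level: (VN₃) for every curve ⟹ the leaf `BDPValueLeafAtThree` (19406) and the H2 conjuncts of 19107 ∕ 19155;
   `HalvesAtThree` ⟸ (VN₃ ∀ W) ∧ the registered stub `stub_imcDivAtThree` (the KolyvaginRoadThree twins follow through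
   `kolyvaginRoadThree_halvesTamAtThree_of_bdpValueLeaf_of_imcDivTamStub`, companion file).

5. (appended, §3) `classicalFrameValue₃_of_normContinuity_of_frames`: (VN₃) ∧ (a frame exists at every datum and every
   `ι'`) ⟹ THEOREM C typed at `W` — so modulo frame existence THEOREM C typed ⟺ (VC₃) ⟺ (VN₃).

HONEST FRAMING: every theorem here is an implication; (VN₃) is NOT discharged, NOT a kernel theorem and NOT a
Literature fact (no print states it at `3 ∥ N`; memo THEOREM C ⟹ it); nothing is booked; no node, label or
census count moves (T7); O2 stays OPEN; BSD(E,3) is proved for no class by this file.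

References: [Castella2018] Camb. J. Math. 6 (2018) = arXiv:1704.06608, Thm. 3.1–3.2 (pp. 8–9); [CastellaHsieh2018]
Math. Ann. 370, §3.3; [Cassels1986] Ch. 4 Lemma 2.1; [Washington1997] §7.1; cell memo PROOF-BDP v1.8 §20.
-/

noncomputable section

open scoped Classical Topology

open Filter WeierstrassCurve NumberField IsDedekindDomain Field PowerSeries
  Literature.NumberTheory.EllipticCurves Literature.NumberTheory.EllipticCurves.ModularForms
  Literature.NumberTheory.EllipticCurves.Rank1Residual
  Literature.NumberTheory.GaloisRepresentations Literature.NumberTheory.GaloisCohomology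
  Summit.BirchSwinnertonDyer.Rank1Residual Summit.BirchSwinnertonDyer.Rank1Residual.X11b
  Summit.BirchSwinnertonDyer.Rank1Residual.X11b.AcSelmer
  Summit.BirchSwinnertonDyer.Rank1Residual.X11b.CongruenceLimit
  Summit.BirchSwinnertonDyer.Rank1Residual.X11b.Halves
  Summit.BirchSwinnertonDyer.Rank1Residual.X11b.Three
  Summit.BirchSwinnertonDyer.BirchSwinnertonDyer.Theses.ClassRecordThree

namespace Summit.BirchSwinnertonDyer.BirchSwinnertonDyer.Theorems

/-! ## §1 H2@3 from NORM continuity at `𝟙` (VN₃), one curve at a time -/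

section OneCurve

variable {W : WeierstrassCurve ℚ} [W.IsElliptic] [W.IsGloballyMinimal]

/-- **H2@3 from NORM CONTINUITY AT `𝟙` (VN₃).** If at every X11b@3 classical datum and every `ι'` inducing `𝔭` there
are virtual periods `Ω_K ≠ 0`, `Ω_p ≠ 0` such that the 3-adic NORMS of Castella's display
`‖ι'⁻¹(bdpInterpolationValue 3 f 𝔭 φ_k n_k Ω_K)·Ω_p^{4n_k}‖` tend to `‖(1 − a₃(E)·3⁻¹)·log_{ω_E} P‖²` along every
interpolation sequence `(φ_k, n_k, r_k)` with `r_k(γ) → 1`, then the ∀-frame H2 of record `Three.BDPValueAt₃ W`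
holds. Proof: H2 is the norm identity `‖[T⁰]L'‖ = ‖c‖²` at every frame (`bdpValueAt₃_iff_norm_constantCoeff`), and
the companion file's norm rigidity delivers it at the frame read in `𝓞_{ℂ₃}⟦T⟧` (`R1.isBDPLFunctionInt_map`); `c ≠ 0` by `a₃ = ±1` and
`log_{ω_E} P ≠ 0`. The hypothesis carries NO unit, NO `R₀`-membership and NO `p`-adic `L`-function: only 3-adic
absolute values of normalised complex special values. CONDITIONAL on (VN₃), not in print at `3 ∥ N`.
[cite: Castella2018, Thm. 3.1–3.2 (arXiv:1704.06608 pp. 8–9) (display and value shape only; nothing asserted at p = 3)] -/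
theorem bdpValueAt₃_of_normContinuity
    (hVN : ∀ (N : ℕ) [NeZero N] (K : Type) [Field K] [NumberField K] (Dt : ModularParametrizationData W N)
      (H : HeegnerDatum N (NumberField.discr K)) (ι : K →+* ℂ) (P : (W.baseChange K).toAffine.Point),
      ClassX11b W 3 → Surj W 3 → W.conductorNorm ℤ = N → IsImaginaryQuadratic K →
      Odd (NumberField.discr K) → SatisfiesHeegnerHypothesis N K →
      (W.quadraticTwist (NumberField.discr K : ℚ)).entireLFunction 1 ≠ 0 →
      WeierstrassCurve.Affine.Point.map ι.toRatAlgHom P = heegnerPointComplex Dt H →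
      ¬ (3 : ℤ) ∣ Dt.c → ¬ IsOfFinAddOrder P →
      ∀ (κ : ZpExtension K 3), κ.IsAnticyclotomic →
        ∀ (γ : Field.absoluteGaloisGroup K) [Fact (κ.IsTopGenerator γ)]
          (𝔭 : HeightOneSpectrum (𝓞 K)) (h𝔭 : ((3 : ℕ) : 𝓞 K) ∈ 𝔭.asIdeal)
          (he : 𝔭.asIdeal.ramificationIdx (𝓞 ℚ) = 1) (hf : 𝔭.asIdeal.inertiaDeg (𝓞 ℚ) = 1),
          ∀ (f : CuspForm (CongruenceSubgroup.Gamma0 N) 2), IsNewformOf W f →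
            ∀ (ι' : PadicAlgCl 3 ≃+* ℂ), InducesPrime ι' 𝔭 →
              ∃ (ΩK : ℂ) (Ωp : ℂ_[3]), ΩK ≠ 0 ∧ Ωp ≠ 0 ∧
                ∀ (φ : ℕ → HeckeCharacter K) (n : ℕ → ℕ) (r : ℕ → FramedGaloisRep K (PadicAlgCl 3) 1),
                  (∀ k, 0 < n k) → (∀ k (v : HeightOneSpectrum (𝓞 K)), (φ k).IsUnramifiedAt v) →
                  (∀ k, (φ k).HasInfinityType (fun _ ↦ (n k : ℤ)) (fun _ ↦ -(n k : ℤ))) →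
                  (∀ k, IsPAdicAvatarOf ι' (φ k) (r k)) → (∀ k, FactorsThroughZp κ (r k)) →
                  Tendsto (fun k ↦ avatarValueAt (r k) γ) atTop (𝓝 1) →
                  Tendsto (fun k ↦ ‖((ι'.symm (bdpInterpolationValue 3 f 𝔭 (φ k) (n k) ΩK) :
                    PadicAlgCl 3) : ℂ_[3]) * Ωp ^ (4 * n k)‖) atTop
                    (𝓝 (‖algebraMap ℚ_[3] ℂ_[3] (((1 : ℚ_[3]) - ((W.LFunction 3 : ℤ) : ℚ_[3]) *
                        (3 : ℚ_[3])⁻¹) * logOmega W 3 (embAt K 3 𝔭 h𝔭 he hf) P)‖ ^ 2))) :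
    BDPValueAt₃ W := by
  rw [bdpValueAt₃_iff_norm_constantCoeff]
  intro N _ K _ _ Dt H ι P hX hsurj hN hK hodd hheeg hL1 hP hc hP0 κ hκ γ hγ 𝔭 h𝔭 he hf f hfW ι' hι'
    ΩK' Ωp' L' hΩK' hL'
  obtain ⟨ΩK, Ωp, hΩK, hΩp, hcont⟩ :=
    hVN N K Dt H ι P hX hsurj hN hK hodd hheeg hL1 hP hc hP0 κ hκ γ 𝔭 h𝔭 he hf f hfW ι' hι'
  -- the target norm is non-zero
  have ha : W.LFunction 3 = 1 ∨ W.LFunction 3 = -1 :=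
    lFunction_eq_one_or_eq_neg_one_of_isNewformOf W hfW hX.2.2.1
  have hx : ((1 : ℚ_[3]) - ((W.LFunction 3 : ℤ) : ℚ_[3]) * (3 : ℚ_[3])⁻¹) *
      logOmega W 3 (embAt K 3 𝔭 h𝔭 he hf) P ≠ 0 := by
    refine mul_ne_zero ?_ (R1.logOmega_ne_zero W 3 (embAt K 3 𝔭 h𝔭 he hf) hP0)
    rcases ha with ha | ha <;> rw [ha] <;> norm_num
  have hN0 : ‖algebraMap ℚ_[3] ℂ_[3] (((1 : ℚ_[3]) - ((W.LFunction 3 : ℤ) : ℚ_[3]) * (3 : ℚ_[3])⁻¹) *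
      logOmega W 3 (embAt K 3 𝔭 h𝔭 he hf) P)‖ ^ 2 ≠ 0 :=
    pow_ne_zero _ (norm_ne_zero_iff.mpr
      ((map_ne_zero_iff _ (algebraMap ℚ_[3] ℂ_[3]).injective).mpr hx))
  -- the given frame, read in `𝓞_{ℂ₃}⟦T⟧`
  have hΩp' : ((Ωp' : unrIntegers 3) : ℂ_[3]) ≠ 0 := by
    rw [Ne, ZeroMemClass.coe_eq_zero]
    exact Units.ne_zero Ωp'
  have hQ' := R1.isBDPLFunctionInt_map hL'
  have key := intSeries_norm_constantCoeff_eq_of_isBDPLFunctionInt_of_continuousNorms (p := 3) (by decide)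
    hK hκ hγ.out hΩK hΩK' hΩp hΩp' hcont hN0 hQ'
  have hcoe : ((PowerSeries.constantCoeff (PowerSeries.map (R1.unrToCpInt 3) L') : 𝓞_ℂ_[3]) : ℂ_[3]) =
      ((PowerSeries.constantCoeff L' : unrIntegers 3) : ℂ_[3]) := by
    rw [← PowerSeries.coeff_zero_eq_constantCoeff_apply, PowerSeries.coeff_map,
      PowerSeries.coeff_zero_eq_constantCoeff_apply, R1.coe_unrToCpInt]
  rw [← hcoe]
  exact key

/-- **(VN₃) ⟸ (VC₃), one curve**: value continuity at `𝟙` (g2's hypothesis: the displays tend to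
`u·((1 − a₃·3⁻¹)·log_{ω_E} P)²` with `u ∈ R₀ˣ`) implies norm continuity — take norms; `‖u‖ = 1`
(`norm_coe_units_unrIntegers`). So (VN₃) is WEAKER than (VC₃), hence than THEOREM C typed. [folklore] -/
theorem normContinuity₃_of_valueContinuity
    (hVC : ∀ (N : ℕ) [NeZero N] (K : Type) [Field K] [NumberField K] (Dt : ModularParametrizationData W N)
      (H : HeegnerDatum N (NumberField.discr K)) (ι : K →+* ℂ) (P : (W.baseChange K).toAffine.Point),
      ClassX11b W 3 → Surj W 3 → W.conductorNorm ℤ = N → IsImaginaryQuadratic K →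
      Odd (NumberField.discr K) → SatisfiesHeegnerHypothesis N K →
      (W.quadraticTwist (NumberField.discr K : ℚ)).entireLFunction 1 ≠ 0 →
      WeierstrassCurve.Affine.Point.map ι.toRatAlgHom P = heegnerPointComplex Dt H →
      ¬ (3 : ℤ) ∣ Dt.c → ¬ IsOfFinAddOrder P →
      ∀ (κ : ZpExtension K 3), κ.IsAnticyclotomic →
        ∀ (γ : Field.absoluteGaloisGroup K) [Fact (κ.IsTopGenerator γ)]
          (𝔭 : HeightOneSpectrum (𝓞 K)) (h𝔭 : ((3 : ℕ) : 𝓞 K) ∈ 𝔭.asIdeal)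
          (he : 𝔭.asIdeal.ramificationIdx (𝓞 ℚ) = 1) (hf : 𝔭.asIdeal.inertiaDeg (𝓞 ℚ) = 1),
          ∀ (f : CuspForm (CongruenceSubgroup.Gamma0 N) 2), IsNewformOf W f →
            ∀ (ι' : PadicAlgCl 3 ≃+* ℂ), InducesPrime ι' 𝔭 →
              ∃ (ΩK : ℂ) (Ωp : ℂ_[3]) (u : (unrIntegers 3)ˣ), ΩK ≠ 0 ∧ Ωp ≠ 0 ∧
                ∀ (φ : ℕ → HeckeCharacter K) (n : ℕ → ℕ) (r : ℕ → FramedGaloisRep K (PadicAlgCl 3) 1),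
                  (∀ k, 0 < n k) → (∀ k (v : HeightOneSpectrum (𝓞 K)), (φ k).IsUnramifiedAt v) →
                  (∀ k, (φ k).HasInfinityType (fun _ ↦ (n k : ℤ)) (fun _ ↦ -(n k : ℤ))) →
                  (∀ k, IsPAdicAvatarOf ι' (φ k) (r k)) → (∀ k, FactorsThroughZp κ (r k)) →
                  Tendsto (fun k ↦ avatarValueAt (r k) γ) atTop (𝓝 1) →
                  Tendsto (fun k ↦ ((ι'.symm (bdpInterpolationValue 3 f 𝔭 (φ k) (n k) ΩK) :
                    PadicAlgCl 3) : ℂ_[3]) * Ωp ^ (4 * n k)) atTop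
                    (𝓝 (((u : unrIntegers 3) : ℂ_[3]) *
                      (algebraMap ℚ_[3] ℂ_[3] (((1 : ℚ_[3]) - ((W.LFunction 3 : ℤ) : ℚ_[3]) *
                        (3 : ℚ_[3])⁻¹) * logOmega W 3 (embAt K 3 𝔭 h𝔭 he hf) P)) ^ 2))) :
    ∀ (N : ℕ) [NeZero N] (K : Type) [Field K] [NumberField K] (Dt : ModularParametrizationData W N)
      (H : HeegnerDatum N (NumberField.discr K)) (ι : K →+* ℂ) (P : (W.baseChange K).toAffine.Point),
      ClassX11b W 3 → Surj W 3 → W.conductorNorm ℤ = N → IsImaginaryQuadratic K →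
      Odd (NumberField.discr K) → SatisfiesHeegnerHypothesis N K →
      (W.quadraticTwist (NumberField.discr K : ℚ)).entireLFunction 1 ≠ 0 →
      WeierstrassCurve.Affine.Point.map ι.toRatAlgHom P = heegnerPointComplex Dt H →
      ¬ (3 : ℤ) ∣ Dt.c → ¬ IsOfFinAddOrder P →
      ∀ (κ : ZpExtension K 3), κ.IsAnticyclotomic →
        ∀ (γ : Field.absoluteGaloisGroup K) [Fact (κ.IsTopGenerator γ)]
          (𝔭 : HeightOneSpectrum (𝓞 K)) (h𝔭 : ((3 : ℕ) : 𝓞 K) ∈ 𝔭.asIdeal)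
          (he : 𝔭.asIdeal.ramificationIdx (𝓞 ℚ) = 1) (hf : 𝔭.asIdeal.inertiaDeg (𝓞 ℚ) = 1),
          ∀ (f : CuspForm (CongruenceSubgroup.Gamma0 N) 2), IsNewformOf W f →
            ∀ (ι' : PadicAlgCl 3 ≃+* ℂ), InducesPrime ι' 𝔭 →
              ∃ (ΩK : ℂ) (Ωp : ℂ_[3]), ΩK ≠ 0 ∧ Ωp ≠ 0 ∧
                ∀ (φ : ℕ → HeckeCharacter K) (n : ℕ → ℕ) (r : ℕ → FramedGaloisRep K (PadicAlgCl 3) 1),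
                  (∀ k, 0 < n k) → (∀ k (v : HeightOneSpectrum (𝓞 K)), (φ k).IsUnramifiedAt v) →
                  (∀ k, (φ k).HasInfinityType (fun _ ↦ (n k : ℤ)) (fun _ ↦ -(n k : ℤ))) →
                  (∀ k, IsPAdicAvatarOf ι' (φ k) (r k)) → (∀ k, FactorsThroughZp κ (r k)) →
                  Tendsto (fun k ↦ avatarValueAt (r k) γ) atTop (𝓝 1) →
                  Tendsto (fun k ↦ ‖((ι'.symm (bdpInterpolationValue 3 f 𝔭 (φ k) (n k) ΩK) :
                    PadicAlgCl 3) : ℂ_[3]) * Ωp ^ (4 * n k)‖) atTop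
                    (𝓝 (‖algebraMap ℚ_[3] ℂ_[3] (((1 : ℚ_[3]) - ((W.LFunction 3 : ℤ) : ℚ_[3]) *
                        (3 : ℚ_[3])⁻¹) * logOmega W 3 (embAt K 3 𝔭 h𝔭 he hf) P)‖ ^ 2)) := by
  intro N _ K _ _ Dt H ι P hX hsurj hN hK hodd hheeg hL1 hP hc hP0 κ hκ γ _ 𝔭 h𝔭 he hf f hfW ι' hι'
  obtain ⟨ΩK, Ωp, u, hΩK, hΩp, hcont⟩ :=
    hVC N K Dt H ι P hX hsurj hN hK hodd hheeg hL1 hP hc hP0 κ hκ γ 𝔭 h𝔭 he hf f hfW ι' hι'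
  refine ⟨ΩK, Ωp, hΩK, hΩp, fun φ n r hn hunr hinf hr hrκ hlim ↦ ?_⟩
  have h := (hcont φ n r hn hunr hinf hr hrκ hlim).norm
  rwa [norm_mul, norm_coe_units_unrIntegers 3 u, one_mul, norm_pow] at h

end OneCurve

/-! ## §2 Item level: (VN₃) for every curve ⟹ the H2 leaf and the crux modulo its H3 stub -/

/-- **(VN₃) for every curve ⟹ the H2 leaf `BDPValueLeafAtThree`** (item 19406; hence the H2 conjuncts of cruxes
19107 ∕ 19155 by `classRecordThree_halvesAtThree_of_bdpValueLeaf_of_imcDivStub` etc.). CONDITIONAL on (VN₃).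
[cite: Castella2018, Thm. 3.1–3.2 (arXiv:1704.06608 pp. 8–9) (display shape only; nothing asserted at p = 3)] -/
theorem classRecordThree_bdpValueLeafAtThree_of_normContinuity
    (hVN : ∀ (W : WeierstrassCurve ℚ) [W.IsElliptic] [W.IsGloballyMinimal],
      ∀ (N : ℕ) [NeZero N] (K : Type) [Field K] [NumberField K] (Dt : ModularParametrizationData W N)
      (H : HeegnerDatum N (NumberField.discr K)) (ι : K →+* ℂ) (P : (W.baseChange K).toAffine.Point),
      ClassX11b W 3 → Surj W 3 → W.conductorNorm ℤ = N → IsImaginaryQuadratic K →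
      Odd (NumberField.discr K) → SatisfiesHeegnerHypothesis N K →
      (W.quadraticTwist (NumberField.discr K : ℚ)).entireLFunction 1 ≠ 0 →
      WeierstrassCurve.Affine.Point.map ι.toRatAlgHom P = heegnerPointComplex Dt H →
      ¬ (3 : ℤ) ∣ Dt.c → ¬ IsOfFinAddOrder P →
      ∀ (κ : ZpExtension K 3), κ.IsAnticyclotomic →
        ∀ (γ : Field.absoluteGaloisGroup K) [Fact (κ.IsTopGenerator γ)]
          (𝔭 : HeightOneSpectrum (𝓞 K)) (h𝔭 : ((3 : ℕ) : 𝓞 K) ∈ 𝔭.asIdeal)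
          (he : 𝔭.asIdeal.ramificationIdx (𝓞 ℚ) = 1) (hf : 𝔭.asIdeal.inertiaDeg (𝓞 ℚ) = 1),
          ∀ (f : CuspForm (CongruenceSubgroup.Gamma0 N) 2), IsNewformOf W f →
            ∀ (ι' : PadicAlgCl 3 ≃+* ℂ), InducesPrime ι' 𝔭 →
              ∃ (ΩK : ℂ) (Ωp : ℂ_[3]), ΩK ≠ 0 ∧ Ωp ≠ 0 ∧
                ∀ (φ : ℕ → HeckeCharacter K) (n : ℕ → ℕ) (r : ℕ → FramedGaloisRep K (PadicAlgCl 3) 1),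
                  (∀ k, 0 < n k) → (∀ k (v : HeightOneSpectrum (𝓞 K)), (φ k).IsUnramifiedAt v) →
                  (∀ k, (φ k).HasInfinityType (fun _ ↦ (n k : ℤ)) (fun _ ↦ -(n k : ℤ))) →
                  (∀ k, IsPAdicAvatarOf ι' (φ k) (r k)) → (∀ k, FactorsThroughZp κ (r k)) →
                  Tendsto (fun k ↦ avatarValueAt (r k) γ) atTop (𝓝 1) →
                  Tendsto (fun k ↦ ‖((ι'.symm (bdpInterpolationValue 3 f 𝔭 (φ k) (n k) ΩK) :
                    PadicAlgCl 3) : ℂ_[3]) * Ωp ^ (4 * n k)‖) atTop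
                    (𝓝 (‖algebraMap ℚ_[3] ℂ_[3] (((1 : ℚ_[3]) - ((W.LFunction 3 : ℤ) : ℚ_[3]) *
                        (3 : ℚ_[3])⁻¹) * logOmega W 3 (embAt K 3 𝔭 h𝔭 he hf) P)‖ ^ 2))) :
    BDPValueLeafAtThree :=
  fun W _ _ _ ↦ bdpValueAt₃_of_normContinuity (hVN W)

/-- **The crux modulo (VN₃) and its registered H3 stub**: `HalvesAtThree` ⟸ (VN₃) for every curve ∧ the two-loci H3
statement `stub_imcDivAtThree` (verbatim). H3 is OPEN; nothing is discharged.
[cite: Castella2018, Thm. 3.3 (arXiv:1704.06608 p. 9) (shape of H3 only; open at p = 3)] -/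
theorem classRecordThree_halvesAtThree_of_normContinuity_of_imcDivStub
    (hVN : ∀ (W : WeierstrassCurve ℚ) [W.IsElliptic] [W.IsGloballyMinimal],
      ∀ (N : ℕ) [NeZero N] (K : Type) [Field K] [NumberField K] (Dt : ModularParametrizationData W N)
      (H : HeegnerDatum N (NumberField.discr K)) (ι : K →+* ℂ) (P : (W.baseChange K).toAffine.Point),
      ClassX11b W 3 → Surj W 3 → W.conductorNorm ℤ = N → IsImaginaryQuadratic K →
      Odd (NumberField.discr K) → SatisfiesHeegnerHypothesis N K →
      (W.quadraticTwist (NumberField.discr K : ℚ)).entireLFunction 1 ≠ 0 →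
      WeierstrassCurve.Affine.Point.map ι.toRatAlgHom P = heegnerPointComplex Dt H →
      ¬ (3 : ℤ) ∣ Dt.c → ¬ IsOfFinAddOrder P →
      ∀ (κ : ZpExtension K 3), κ.IsAnticyclotomic →
        ∀ (γ : Field.absoluteGaloisGroup K) [Fact (κ.IsTopGenerator γ)]
          (𝔭 : HeightOneSpectrum (𝓞 K)) (h𝔭 : ((3 : ℕ) : 𝓞 K) ∈ 𝔭.asIdeal)
          (he : 𝔭.asIdeal.ramificationIdx (𝓞 ℚ) = 1) (hf : 𝔭.asIdeal.inertiaDeg (𝓞 ℚ) = 1),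
          ∀ (f : CuspForm (CongruenceSubgroup.Gamma0 N) 2), IsNewformOf W f →
            ∀ (ι' : PadicAlgCl 3 ≃+* ℂ), InducesPrime ι' 𝔭 →
              ∃ (ΩK : ℂ) (Ωp : ℂ_[3]), ΩK ≠ 0 ∧ Ωp ≠ 0 ∧
                ∀ (φ : ℕ → HeckeCharacter K) (n : ℕ → ℕ) (r : ℕ → FramedGaloisRep K (PadicAlgCl 3) 1),
                  (∀ k, 0 < n k) → (∀ k (v : HeightOneSpectrum (𝓞 K)), (φ k).IsUnramifiedAt v) →
                  (∀ k, (φ k).HasInfinityType (fun _ ↦ (n k : ℤ)) (fun _ ↦ -(n k : ℤ))) →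
                  (∀ k, IsPAdicAvatarOf ι' (φ k) (r k)) → (∀ k, FactorsThroughZp κ (r k)) →
                  Tendsto (fun k ↦ avatarValueAt (r k) γ) atTop (𝓝 1) →
                  Tendsto (fun k ↦ ‖((ι'.symm (bdpInterpolationValue 3 f 𝔭 (φ k) (n k) ΩK) :
                    PadicAlgCl 3) : ℂ_[3]) * Ωp ^ (4 * n k)‖) atTop
                    (𝓝 (‖algebraMap ℚ_[3] ℂ_[3] (((1 : ℚ_[3]) - ((W.LFunction 3 : ℤ) : ℚ_[3]) *
                        (3 : ℚ_[3])⁻¹) * logOmega W 3 (embAt K 3 𝔭 h𝔭 he hf) P)‖ ^ 2)))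
    (h3 : ∀ (W : WeierstrassCurve ℚ) [W.IsElliptic] [W.IsGloballyMinimal], ClassX11b W 3 →
      (Ram W 3 → W.HasSplitMultiplicativeReductionAtPrime 3 → IMCDivAt₃ W) ∧
        (¬ Ram W 3 → Surj W 3 → IMCDivAt₃ W)) :
    HalvesAtThree :=
  classRecordThree_halvesAtThree_of_bdpValueLeaf_of_imcDivStub
    (classRecordThree_bdpValueLeafAtThree_of_normContinuity hVN) h3

/-! ## §3 (VN₃) is THEOREM C typed minus frame existence (appended) -/

section Frames

variable {W : WeierstrassCurve ℚ} [W.IsElliptic] [W.IsGloballyMinimal]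

/-- **(VN₃) ∧ (frames exist at every `ι'`) ⟹ THEOREM C typed**, one curve: if norm continuity at `𝟙` holds and at every
X11b@3 classical datum and every `ι'` inducing `𝔭` SOME frame `(Ω_K ≠ 0, Ω_p ∈ R₀ˣ, L ∈ R₀⟦T⟧)` with Castella's
interpolation property exists (the ∀-`ι'` form of H1's ∃-frame), then the frame-value statement `h12` of
`Three.bdpValueAt₃_of_frameValue` (= THEOREM C typed at `W`, = g0's `hC W`) holds: the frame's value at `𝟙` is
`u·((1 − a₃·3⁻¹)·log_{ω_E} P)²` by `bdpValueAt₃_of_normContinuity`. With g2's `valueContinuity₃_of_classicalFrameValue` and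
`normContinuity₃_of_valueContinuity`: modulo frame existence, THEOREM C typed ⟺ (VC₃) ⟺ (VN₃). CONDITIONAL; nothing
asserted. [cite: Castella2018, Thm. 3.1–3.2 (arXiv:1704.06608 pp. 8–9) (shapes only)] -/
theorem classicalFrameValue₃_of_normContinuity_of_frames
    (hVN : ∀ (N : ℕ) [NeZero N] (K : Type) [Field K] [NumberField K] (Dt : ModularParametrizationData W N)
      (H : HeegnerDatum N (NumberField.discr K)) (ι : K →+* ℂ) (P : (W.baseChange K).toAffine.Point),
      ClassX11b W 3 → Surj W 3 → W.conductorNorm ℤ = N → IsImaginaryQuadratic K →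
      Odd (NumberField.discr K) → SatisfiesHeegnerHypothesis N K →
      (W.quadraticTwist (NumberField.discr K : ℚ)).entireLFunction 1 ≠ 0 →
      WeierstrassCurve.Affine.Point.map ι.toRatAlgHom P = heegnerPointComplex Dt H →
      ¬ (3 : ℤ) ∣ Dt.c → ¬ IsOfFinAddOrder P →
      ∀ (κ : ZpExtension K 3), κ.IsAnticyclotomic →
        ∀ (γ : Field.absoluteGaloisGroup K) [Fact (κ.IsTopGenerator γ)]
          (𝔭 : HeightOneSpectrum (𝓞 K)) (h𝔭 : ((3 : ℕ) : 𝓞 K) ∈ 𝔭.asIdeal)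
          (he : 𝔭.asIdeal.ramificationIdx (𝓞 ℚ) = 1) (hf : 𝔭.asIdeal.inertiaDeg (𝓞 ℚ) = 1),
          ∀ (f : CuspForm (CongruenceSubgroup.Gamma0 N) 2), IsNewformOf W f →
            ∀ (ι' : PadicAlgCl 3 ≃+* ℂ), InducesPrime ι' 𝔭 →
              ∃ (ΩK : ℂ) (Ωp : ℂ_[3]), ΩK ≠ 0 ∧ Ωp ≠ 0 ∧
                ∀ (φ : ℕ → HeckeCharacter K) (n : ℕ → ℕ) (r : ℕ → FramedGaloisRep K (PadicAlgCl 3) 1),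
                  (∀ k, 0 < n k) → (∀ k (v : HeightOneSpectrum (𝓞 K)), (φ k).IsUnramifiedAt v) →
                  (∀ k, (φ k).HasInfinityType (fun _ ↦ (n k : ℤ)) (fun _ ↦ -(n k : ℤ))) →
                  (∀ k, IsPAdicAvatarOf ι' (φ k) (r k)) → (∀ k, FactorsThroughZp κ (r k)) →
                  Tendsto (fun k ↦ avatarValueAt (r k) γ) atTop (𝓝 1) →
                  Tendsto (fun k ↦ ‖((ι'.symm (bdpInterpolationValue 3 f 𝔭 (φ k) (n k) ΩK) :
                    PadicAlgCl 3) : ℂ_[3]) * Ωp ^ (4 * n k)‖) atTop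
                    (𝓝 (‖algebraMap ℚ_[3] ℂ_[3] (((1 : ℚ_[3]) - ((W.LFunction 3 : ℤ) : ℚ_[3]) *
                        (3 : ℚ_[3])⁻¹) * logOmega W 3 (embAt K 3 𝔭 h𝔭 he hf) P)‖ ^ 2)))
    (hF : ∀ (N : ℕ) [NeZero N] (K : Type) [Field K] [NumberField K] (Dt : ModularParametrizationData W N)
      (H : HeegnerDatum N (NumberField.discr K)) (ι : K →+* ℂ) (P : (W.baseChange K).toAffine.Point),
      ClassX11b W 3 → Surj W 3 → W.conductorNorm ℤ = N → IsImaginaryQuadratic K →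
      Odd (NumberField.discr K) → SatisfiesHeegnerHypothesis N K →
      (W.quadraticTwist (NumberField.discr K : ℚ)).entireLFunction 1 ≠ 0 →
      WeierstrassCurve.Affine.Point.map ι.toRatAlgHom P = heegnerPointComplex Dt H →
      ¬ (3 : ℤ) ∣ Dt.c → ¬ IsOfFinAddOrder P →
      ∀ (κ : ZpExtension K 3), κ.IsAnticyclotomic →
        ∀ (γ : Field.absoluteGaloisGroup K) [Fact (κ.IsTopGenerator γ)]
          (𝔭 : HeightOneSpectrum (𝓞 K)) (h𝔭 : ((3 : ℕ) : 𝓞 K) ∈ 𝔭.asIdeal)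
          (he : 𝔭.asIdeal.ramificationIdx (𝓞 ℚ) = 1) (hf : 𝔭.asIdeal.inertiaDeg (𝓞 ℚ) = 1),
          ∀ (f : CuspForm (CongruenceSubgroup.Gamma0 N) 2), IsNewformOf W f →
            ∀ (ι' : PadicAlgCl 3 ≃+* ℂ), InducesPrime ι' 𝔭 →
              ∃ (ΩK : ℂ) (Ωp : (unrIntegers 3)ˣ) (L : UnrSeries 3),
                ΩK ≠ 0 ∧ IsBDPLFunction ι' 𝔭 κ γ f ΩK ((Ωp : unrIntegers 3) : ℂ_[3]) L) :
    ∀ (N : ℕ) [NeZero N] (K : Type) [Field K] [NumberField K] (Dt : ModularParametrizationData W N)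
      (H : HeegnerDatum N (NumberField.discr K)) (ι : K →+* ℂ) (P : (W.baseChange K).toAffine.Point),
      ClassX11b W 3 → Surj W 3 → W.conductorNorm ℤ = N → IsImaginaryQuadratic K →
      Odd (NumberField.discr K) → SatisfiesHeegnerHypothesis N K →
      (W.quadraticTwist (NumberField.discr K : ℚ)).entireLFunction 1 ≠ 0 →
      WeierstrassCurve.Affine.Point.map ι.toRatAlgHom P = heegnerPointComplex Dt H →
      ¬ (3 : ℤ) ∣ Dt.c → ¬ IsOfFinAddOrder P →
      ∀ (κ : ZpExtension K 3), κ.IsAnticyclotomic →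
        ∀ (γ : Field.absoluteGaloisGroup K) [Fact (κ.IsTopGenerator γ)]
          (𝔭 : HeightOneSpectrum (𝓞 K)) (h𝔭 : ((3 : ℕ) : 𝓞 K) ∈ 𝔭.asIdeal)
          (he : 𝔭.asIdeal.ramificationIdx (𝓞 ℚ) = 1) (hf : 𝔭.asIdeal.inertiaDeg (𝓞 ℚ) = 1),
          ∀ (f : CuspForm (CongruenceSubgroup.Gamma0 N) 2), IsNewformOf W f →
            ∀ (ι' : PadicAlgCl 3 ≃+* ℂ), InducesPrime ι' 𝔭 →
              ∃ (ΩK : ℂ) (Ωp : (unrIntegers 3)ˣ) (L : UnrSeries 3),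
                ΩK ≠ 0 ∧ IsBDPLFunction ι' 𝔭 κ γ f ΩK ((Ωp : unrIntegers 3) : ℂ_[3]) L ∧
                ∃ u : (unrIntegers 3)ˣ, L.HasValueAt 0 (((u : unrIntegers 3) : ℂ_[3]) *
                  (algebraMap ℚ_[3] ℂ_[3] (((1 : ℚ_[3]) - ((W.LFunction 3 : ℤ) : ℚ_[3]) * (3 : ℚ_[3])⁻¹) *
                    logOmega W 3 (embAt K 3 𝔭 h𝔭 he hf) P)) ^ 2) := by
  intro N _ K _ _ Dt H ι P hX hsurj hN hK hodd hheeg hL1 hP hc hP0 κ hκ γ hγ 𝔭 h𝔭 he hf f hfW ι' hι'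
  obtain ⟨ΩK, Ωp, L, hΩK, hL⟩ :=
    hF N K Dt H ι P hX hsurj hN hK hodd hheeg hL1 hP hc hP0 κ hκ γ 𝔭 h𝔭 he hf f hfW ι' hι'
  obtain ⟨u, hu⟩ := bdpValueAt₃_of_normContinuity hVN N K Dt H ι P hX hsurj hN hK hodd hheeg hL1 hP hc hP0
    κ hκ γ 𝔭 h𝔭 he hf f hfW ι' hι' ΩK Ωp L hΩK hL
  exact ⟨ΩK, Ωp, L, hΩK, hL, u, hu⟩

end Frames

end Summit.BirchSwinnertonDyer.BirchSwinnertonDyer.Theorems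

end
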